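import Summits.CriticalPhenomena.PercolationContinuityZ3.Theorems.PercNearOneGluingNoHeavyLowerTailSahiOneStepFreeBlockReduce
import HarnessLib

/-!
# One-step scheme: the partner reduction over an ABSTRACT costly region — pivot-freeness (for the two-sided / free-block / one-odd uses)

Support file (prover prim-ineq-prove-3 gen 53; `--supports stmt-CriticalPhenomena-4575`; memo
`run/shared/lean/prim/prim-ineq-prove-3/PROOF-G53-FREE-BLOCK.md` §5 and FINDING-G53-ONE-ODD.md).  No definitions, no named facts, no sorries,
no `native_decide`.

`…FreeBlockReduce.lift_free` (and `…OddReduce.lift_free_odd`) prove that the reduced partner `B₂ = ↑(B♯ ∖ G)` does not depend on the pivot `e`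
for the specific costly region `G = A ∩ {g ≤ #(K∩ω)}` of the functional `n`.  Their proofs use of `G` only that it is an increasing, `K`-determined,
`e`-dominant region; `lift_free_region` states exactly this (with one coordinate `o ∈ F` exempt from the `e`-domination of `B`, as in
`lift_free_odd`).  The two-sided lumping functional `Ψ` of gen 50 (memo PROOF-G53-TL-FREE-BLOCK.md) has the costly region
`G = (A ∩ {g₁ ≤ #(K∩ω)}) ∪ {g₂ ≤ #(K∩ω)}` — also increasing, `K`-determined and `e`-dominant — so the same freeness holds for its reduction.
-/

noncomputable section

namespace Summit.CriticalPhenomena.PercolationContinuityZ3.Theorems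

namespace SahiOneStep

open MeasureTheory Finset
open Literature.Probability.Percolation (DeterminedBy determinedBy_iff)
open Literature.Probability.LatticeModels (prodBernoulli)
open Literature.Probability.Percolation.DecisionTree (ind)
open scoped Classical

variable {ι : Type*} [Fintype ι]

section free

variable {F : Finset ι} {e : ι} {B : Set (Set ι)}

/-- **THE REDUCED PARTNER DOES NOT DEPEND ON THE PIVOT — abstract costly region** (gen 53).  `K = insert e F`; `G` ANY increasing
`K`-determined region that is `e`-dominant over `F` (`ω ∈ G`, `e ∉ ω`, `j ∈ ω ∩ F` ⟹ `ω − j + e ∈ G`); `B` `K`-determined and `e`-dominated over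
`F ∖ {o}` for one exempt coordinate `o ∈ F`; `B♯ = {ω | every ω' ⊇ ω in G lies in B}`, `B₂ = ↑(B♯ ∖ G)`.  Then `insert e ω ∈ B₂ → ω ∈ B₂` for every
`ω ∌ e`.  (`lift_free` / `lift_free_odd` are the case `G = A ∩ {g ≤ #(K∩ω)}`; the two-sided lumping reduction uses
`G = (A ∩ {g₁ ≤ #(K∩ω)}) ∪ {g₂ ≤ #(K∩ω)}`.) [this work] -/
theorem lift_free_region (heF : e ∉ F) {o : ι} (hoF : o ∈ F) {G : Set (Set ι)} (hGup : IsUpperSet G)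
    (hGK : DeterminedBy G (↑(insert e F) : Set ι)) (hBK : DeterminedBy B (↑(insert e F) : Set ι))
    (hGdom : ∀ j ∈ F, ∀ ω ∈ G, e ∉ ω → j ∈ ω → (ω \ {j}) ∪ {e} ∈ G)
    (hdomB : ∀ j ∈ F, j ≠ o → ∀ ω ∈ B, e ∈ ω → j ∉ ω → (ω \ {e}) ∪ {j} ∈ B) :
    ∀ ω : Set ι, e ∉ ω →
      insert e ω ∈ {ω : Set ι | ∃ ω' : Set ι, ω' ⊆ ω ∧
          ω' ∈ {ω : Set ι | ∀ ω'' : Set ι, ω ⊆ ω'' → ω'' ∈ G → ω'' ∈ B} ∧ ω' ∉ G} →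
      ω ∈ {ω : Set ι | ∃ ω' : Set ι, ω' ⊆ ω ∧
          ω' ∈ {ω : Set ι | ∀ ω'' : Set ι, ω ⊆ ω'' → ω'' ∈ G → ω'' ∈ B} ∧ ω' ∉ G} := by
  set K : Finset ι := insert e F with hKdef
  set Bs : Set (Set ι) := {ω : Set ι | ∀ ω'' : Set ι, ω ⊆ ω'' → ω'' ∈ G → ω'' ∈ B} with hBsdef
  set B₂ : Set (Set ι) := {ω : Set ι | ∃ ω' : Set ι, ω' ⊆ ω ∧ ω' ∈ Bs ∧ ω' ∉ G} with hB₂def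
  have heK : e ∈ K := Finset.mem_insert_self e F
  have hGK' : DeterminedBy G (↑K : Set ι) := hGK
  have hBsup : IsUpperSet Bs := isUpperSet_hgen G B
  have hBsK : DeterminedBy Bs (↑K : Set ι) := determinedBy_hgen hGK' hBK
  have hB₂up : IsUpperSet B₂ := isUpperSet_lift Bs G
  have hB₂Bs : B₂ ⊆ Bs := lift_subset hBsup
  have heo : e ≠ o := fun h => heF (h ▸ hoF)
  have hB₂dom : ∀ j ∈ F, j ≠ o → ∀ ω ∈ B₂, e ∈ ω → j ∉ ω → (ω \ {e}) ∪ {j} ∈ B₂ := by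
    intro j hj hjo
    have hej : e ≠ j := fun h => heF (h ▸ hj)
    exact dominated_lift hej (hGdom j hj) (dominated_hgen_region hej (hGdom j hj) (hdomB j hj hjo))
  -- strong induction on the level of `ω`
  suffices key : ∀ n : ℕ, ∀ ω : Set ι, e ∉ ω → (K.filter (· ∈ ω)).card = n → insert e ω ∈ B₂ → ω ∈ B₂ from
    fun ω heω h => key _ ω heω rfl h
  intro n
  induction n using Nat.strong_induction_on with
  | _ n ih =>
  intro ω heω hn hins
  by_contra hω
  -- (a) no lower `F`-neighbour of `insert e ω` lies in `B₂`
  -- (the lower neighbour is a fresh variable `ω₁ = ω ∖ {j}`, so that the level expression keeps its shape)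
  have hlow : ∀ j ∈ F, j ∈ ω → ∀ ω₁ : Set ι, ω₁ = ω \ {j} → insert e ω₁ ∉ B₂ := by
    intro j hj hjω ω₁ hω₁ hmem
    have hjK : j ∈ K := Finset.mem_insert_of_mem hj
    have hsub₁ : ω₁ ⊆ ω := by rw [hω₁]; exact Set.sdiff_subset
    have hj₁ : j ∉ ω₁ := by rw [hω₁]; exact fun h => h.2 rfl
    have he₁ : e ∉ ω₁ := fun h => heω (hsub₁ h)
    have hlt : (K.filter (· ∈ ω₁)).card < n := by
      rw [← hn]
      apply Finset.card_lt_card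
      refine (Finset.ssubset_iff_of_subset fun x hx => ?_).2 ⟨j, Finset.mem_filter.2 ⟨hjK, hjω⟩, fun h => hj₁ (Finset.mem_filter.1 h).2⟩
      rw [Finset.mem_filter] at hx ⊢
      exact ⟨hx.1, hsub₁ hx.2⟩
    have h1 : ω₁ ∈ B₂ := ih _ hlt ω₁ he₁ rfl hmem
    exact hω (hB₂up hsub₁ h1)
  -- (b) the witness of `insert e ω ∈ B₂` is `insert e ω` itself: `insert e ω ∈ B♯ ∖ G`
  obtain ⟨ω', hsub, hBs', hG'⟩ := hins
  have heω' : e ∈ ω' := by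
    by_contra h
    refine hω ⟨ω', fun x hx => ?_, hBs', hG'⟩
    rcases (Set.mem_insert_iff.1 (hsub hx)) with rfl | hx'
    · exact absurd hx h
    · exact hx'
  have hFω' : ∀ j ∈ F, j ∈ ω → j ∈ ω' := by
    intro j hj hjω
    by_contra hjω'
    refine hlow j hj hjω (ω \ {j}) rfl ⟨ω', fun x hx => ?_, hBs', hG'⟩
    rcases (Set.mem_insert_iff.1 (hsub hx)) with rfl | hx'
    · exact Set.mem_insert _ _
    · exact Set.mem_insert_of_mem _ ⟨hx', fun hxj => hjω' (hxj ▸ hx)⟩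
  have hagree : insert e ω ∩ (↑K : Set ι) = ω' ∩ ↑K := by
    ext x
    simp only [Set.mem_inter_iff, Set.mem_insert_iff, Finset.mem_coe, hKdef, Finset.mem_insert]
    constructor
    · rintro ⟨rfl | hxω, hxK⟩
      · exact ⟨heω', hxK⟩
      · rcases hxK with rfl | hxF
        · exact ⟨heω', Or.inl rfl⟩
        · exact ⟨hFω' x hxF hxω, Or.inr hxF⟩
    · rintro ⟨hxω', hxK⟩
      refine ⟨?_, hxK⟩
      rcases Set.mem_insert_iff.1 (hsub hxω') with h | h
      · exact Or.inl h
      · exact Or.inr h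
  have hinsG : insert e ω ∉ G := fun h => hG' (((determinedBy_iff _ _).1 hGK' _ _ hagree).1 h)
  -- (c) `ω` is maximal outside `B₂` among `K`-patterns, hence `ω ∈ G`
  have hup : ∀ j ∈ K, j ≠ o → j ∉ ω → ω ∪ {j} ∈ B₂ := by
    intro j hj hjo hjω
    rcases Finset.mem_insert.1 hj with rfl | hjF
    · have : ω ∪ {j} = insert j ω := by ext x; simp only [Set.mem_union, Set.mem_singleton_iff, Set.mem_insert_iff]; tauto
      rw [this]; exact ⟨ω', hsub, hBs', hG'⟩
    · have hje : j ≠ e := fun h => heF (h ▸ hjF)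
      have h := hB₂dom j hjF hjo (insert e ω) ⟨ω', hsub, hBs', hG'⟩ (Set.mem_insert e ω)
        (fun h => h.elim (fun h => hje h) (fun h => hjω h))
      have heq : (insert e ω \ {e}) ∪ {j} = ω ∪ {j} := by
        ext x
        simp only [Set.mem_union, Set.mem_sdiff, Set.mem_insert_iff, Set.mem_singleton_iff]
        constructor
        · rintro (⟨rfl | hx, hxe⟩ | rfl)
          · exact absurd rfl hxe
          · exact Or.inl hx
          · exact Or.inr rfl
        · rintro (hx | rfl)
          · exact Or.inl ⟨Or.inr hx, fun hxe => heω (hxe ▸ hx)⟩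
          · exact Or.inr rfl
      rw [heq] at h
      exact h
  have hωG : ω ∈ G := by
    by_cases hωBs : ω ∈ Bs
    · by_contra hG
      exact hω ⟨ω, subset_rfl, hωBs, hG⟩
    · have hex : ∃ z : Set ι, ω ⊆ z ∧ z ∈ G ∧ z ∉ B := by
        by_contra h
        push Not at h
        exact hωBs fun z hz hzG => h z hz hzG
      obtain ⟨z, hωz, hzG, hzB⟩ := hex
      have hagree' : ω ∩ (↑K : Set ι) = z ∩ ↑K := by
        ext x
        simp only [Set.mem_inter_iff, Finset.mem_coe]
        constructor
        · rintro ⟨hx, hxK⟩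
          exact ⟨hωz hx, hxK⟩
        · rintro ⟨hxz, hxK⟩
          refine ⟨?_, hxK⟩
          by_contra hxω
          by_cases hxo : x = o
          · -- the odd coordinate: `e ∉ z`, and trading `o` for `e` in `z` puts `insert e ω` into `G`
            have hoz : o ∈ z := hxo ▸ hxz
            have hoω : o ∉ ω := hxo ▸ hxω
            have hez : e ∉ z := fun hez =>
              hzB ((hBsup (Set.union_subset hωz (Set.singleton_subset_iff.2 hez)) (hB₂Bs (hup e heK heo heω))) z subset_rfl hzG)
            have hz' : (z \ {o}) ∪ {e} ∈ G := hGdom o hoF z hzG hez hoz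
            have hagree2 : ((z \ {o}) ∪ {e}) ∩ (↑K : Set ι) = insert e ω ∩ ↑K := by
              ext i
              simp only [Set.mem_inter_iff, Set.mem_union, Set.mem_sdiff, Set.mem_singleton_iff, Set.mem_insert_iff, Finset.mem_coe]
              constructor
              · rintro ⟨⟨hiz, hio⟩ | rfl, hiK⟩
                · refine ⟨Or.inr ?_, hiK⟩
                  by_contra hiω
                  exact hzB ((hBsup (Set.union_subset hωz (Set.singleton_subset_iff.2 hiz)) (hB₂Bs (hup i hiK hio hiω))) z subset_rfl hzG)
                · exact ⟨Or.inl rfl, hiK⟩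
              · rintro ⟨rfl | hiω, hiK⟩
                · exact ⟨Or.inr rfl, hiK⟩
                · exact ⟨Or.inl ⟨hωz hiω, fun hio => hoω (hio ▸ hiω)⟩, hiK⟩
            exact hinsG (((determinedBy_iff _ _).1 hGK' _ _ hagree2).1 hz')
          · have h1 : ω ∪ {x} ∈ Bs := hB₂Bs (hup x hxK hxo hxω)
            have h2 : z ∈ Bs := hBsup (Set.union_subset hωz (Set.singleton_subset_iff.2 hxz)) h1
            exact hzB (h2 z subset_rfl hzG)
      exact ((determinedBy_iff _ _).1 hGK' _ _ hagree').2 hzG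
  exact hinsG (hGup (Set.subset_insert e ω) hωG)

end free

end SahiOneStep

end Summit.CriticalPhenomena.PercolationContinuityZ3.Theorems
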